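import Summits.QuantumFields.BalabanUV.Beta.GAN24.SymPush3LambdaGaugeSlotCells

/-!
# `BalabanUV.Beta.GAN24.SymPush3LambdaKernelCells` — binder row G-an2-4 ∕ (CONV-C), TRANSFER-III, the (III′) S-slot (b) of the END, born-Λ contact letter `hCg` (road-P2 M.104's
# 3rd hypothesis), TABLE HALF («mksym lane»), PART 6: **A PURE-GAUGE LEG IN ANY SLOT OF `push₃ l r w SΛ`, `SΛ = SLam L c (symHessFFAt ρ L)`, AND THE CONTACT TERM OF THE Λ PUSH
# AS TWO Λ ONE-GAUGE CELLS WITH THE KERNEL `q¹_sym = symLinKerAt ρ`** — the decl-by-decl twin of leaf-02 g47's `Push3LambdaKernelCells` (§3 table slot for a transversal family,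
# §4 the right slot by antisymmetry, §5 `contact_lambda_eq_cells`) with `hessFFAt ↦ symHessFFAt`, `linKerAt ↦ symLinKerAt`, over MY PART 5 `SymPush3LambdaGaugeSlotCells` and
# leaf-02 g47's `SymHessianGaugeLegContact` BY NAME
# (G-an2-4 CRUX TEAM (2), leaf prover `b2b-balaban-gan24-formalise-leaf-01`, gen 90)

WHAT IS PROVED (generic `d`, box root; [folklore]): `vertexW_dz_lambda_eq_zero`, `push₃_gaugeTable_lambda_eq_zero` (transversal family), `push₃_transpose_lambda`, `push₃_gaugeRight_lambda`,
**`contact_lambda_eq_cells`**: `push₃ lᴱ rᴱ wᴱ SΛ − push₃ lᴮ rᴮ wᴮ SΛ` `(x′,z′,inl α,inl β)` `= Σ'_z Σ_b rᴱ β z′ b z·Σ'_u Σ_κ wᴱ κ′ u′ κ u·KΛ_sym(λ_L αx′; κ,u; b,z) − (legs exchanged)`,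
`KΛ_sym(ψ; κ,u; b,z) = −Σ_μ Σ'_y c μ y κ u·(w₄(ψ; b,z; μ,y)·q¹_sym,ρ_{(μ,y)}(b,z)∕2)`.
NOT HERE: the factorised form and the bracket (PART 7 `SymContactLambdaCellFactorised`), the entry bound (PART 8), any count.

NOT IN PRINT; OUR BOOKKEEPING ([folklore]; 0 `def`, 0 cited fact, 0 `def … : Prop`, 0 sorry).  HONEST FRAMING (cell contract, verbatim): «discharging `BetaPertH` makes
Bałaban's UV stability UNCONDITIONAL — a real constructive-QFT result; it is NOT the continuum limit and NOT the Clay problem.»  HONEST DEPENDENCY (verbatim): «continuum YM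
on T⁴ ⇐ BetaPertH ∧ nine spine estimates (0/9 proved); BetaPertH ⇐ (D1) ∧ (D4) ∧ CAP+tail; G-an2-4 gates asym, D1 and NE2/3/4.»  Discharges NO letter of M.104 by itself;
NEVER «G-an2-4 closed» as (CONV-C); NOT D1, NOT `BetaPertH`, NOT continuum, NOT Clay.  2026-08-28; no existing file touched.
-/

open Finset
open scoped BigOperators Nat
open Literature.MathematicalPhysics.QuantumFieldTheory.LatticeForm (quo)
open Literature.MathematicalPhysics.QuantumFieldTheory.Balaban1983to89
open Literature.MathematicalPhysics.QuantumFieldTheory.Balaban1983to89.Beta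
open AffineAveraging AveragingContours AveragingHessianKernels AveragingContoursRooted AveragingHessianKernelsRooted
open B12Sec2to5 (l1 l1_nonneg)
open B4ContourShift (supNorm supNorm_nonneg)
open ExpKernelCalculus (MKer Decays VertexFamily Zl Zl_nonneg Zl_pos summable_exp_shift)
open OneStepResolventKernel (Fib LocStencil)
open InterLevelTransport (SLam locStencil_SLam)
open KernelWard (divV)
open AveragingWardStencils (b6UnitVec_eq)
open Summit.QuantumFields.BalabanUV.Beta.LinearGaugeVH (nearBox mem_nearBox summable_of_finsupp)
open Summit.QuantumFields.BalabanUV.Beta.SymAveragingHessianCounts (symHessFFAt symHessKerAt symLinKerAt symHessKerAt_eq_zero_left symHessKerAt_eq_zero_right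
  abs_symHessKerAt_le biLoc_symHessFFAt)
open Summit.QuantumFields.BalabanUV.Beta.GAN24.HessianGaugeLegContact (exists_finset_near)
open Summit.QuantumFields.BalabanUV.Beta.GAN24.SymHessianGaugeLegContact (SLam_symHessFFAt_inl_inl SLam_symHessFFAt_antisymm
  tsum_coeff_mul_symHessKerAt_eq_sum SLam_symHessFFAt_inl_inl_eq_zero_of_not_mem tsum_dz_mul_SLam_symHessFFAt)
open Summit.QuantumFields.BalabanUV.Beta.GAN24.Push4 (vertexW vertexW_apply)
open Summit.QuantumFields.BalabanUV.Beta.GAN24.Push4NestAux (decays_vertexW_of_locStencil abs_le_of_decays)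
open Summit.QuantumFields.BalabanUV.Beta.GAN24.Push3 (push₃ push₃_inl_inl)
open Summit.QuantumFields.BalabanUV.Beta.GAN24.Push3GaugeSlotCells (tsum_comm_of_window)
open Summit.QuantumFields.BalabanUV.Beta.GAN24.Push3LegTelescope (push₃_sub_left push₃_sub_right push₃_sub_table)

open Summit.QuantumFields.BalabanUV.Beta.GAN24.SymPush3LambdaGaugeSlotCells (locStencil_SLam_symHessFFAt summable_mul_SLam_symHessFFAt_idx
  vertexW_lambda_antisymm vertexW_lambda_eq_zero_of_not_window exists_vertexW_lambda_bound push₃_gaugeLeft_lambda)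

noncomputable section

namespace Summit.QuantumFields.BalabanUV.Beta.GAN24.SymPush3LambdaKernelCells

variable {d : ℕ}
variable (l r w : Fin (d + 1) → (Fin (d + 1) → ℤ) → Fin (d + 1) → (Fin (d + 1) → ℤ) → ℝ)
variable (lam : Fin (d + 1) → (Fin (d + 1) → ℤ) → (Fin (d + 1) → ℤ) → ℝ)

/-! ## §3 THE TABLE SLOT vanishes for a transversal coefficient family -/

section Table

variable {L : ℕ} {rr : Fin (d + 1) → ℕ} {c : Fin (d + 1) → (Fin (d + 1) → ℤ) → Fin (d + 1) → (Fin (d + 1) → ℤ) → ℝ} {Cc δ Clam : ℝ}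

/-- [folklore] **THE Λ VERTEX THROUGH A PURE-GAUGE TABLE LEG VANISHES FOR A TRANSVERSAL FAMILY** (`divV SΛ = 0` — for Bałaban's coefficients an2∕leaf-10's
`WardLocusStep.divV_SLam_lamCoeffK_E2_eq_zero`; bounded gauge function; one summation by parts in the index site). -/
theorem vertexW_dz_lambda_eq_zero (hL : 1 ≤ L) (hrr : rr ∈ box (d + 1) L) (hc : ∀ μ y κ u, |c μ y κ u| ≤ Cc * Real.exp (-δ * l1 ((L : ℤ) • y - u)))
    (hδ : 0 < δ) (hCc : 0 ≤ Cc) (hdiv : ∀ u, divV (SLam L c (fun μ y => symHessFFAt (toSite rr) L μ y)) u = 0)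
    (hlam : ∀ μ y u, |lam μ y u| ≤ Clam) (κ' : Fin (d + 1)) (u' x z : Fin (d + 1) → ℤ) (a b : Fin (d + 1)) :
    vertexW (fun μ y κ u => dz (lam μ y) κ u) (SLam L c (fun μ y => symHessFFAt (toSite rr) L μ y)) κ' u' x z (Sum.inl a) (Sum.inl b) = 0 := by
  haveI : NeZero L := ⟨by omega⟩
  set S := SLam L c (fun μ y => symHessFFAt (toSite rr) L μ y) with hSdef
  have hs1 : ∀ κ, Summable fun u => lam κ' u' (u + unitVec κ) * S κ u x z (Sum.inl a) (Sum.inl b) := fun κ => by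
    have h := summable_mul_SLam_symHessFFAt_idx hL hrr hc hδ hCc (g := fun u => lam κ' u' (u + unitVec κ)) (fun u => hlam κ' u' _) κ x z a b
    exact h.congr fun u => by rw [hSdef]
  have hs2 : ∀ κ, Summable fun u => lam κ' u' u * S κ u x z (Sum.inl a) (Sum.inl b) := fun κ => by
    have h := summable_mul_SLam_symHessFFAt_idx hL hrr hc hδ hCc (g := fun u => lam κ' u' u) (fun u => hlam κ' u' _) κ x z a b
    exact h.congr fun u => by rw [hSdef]
  have hs3 : ∀ κ, Summable fun u => lam κ' u' u * S κ (u - unitVec κ) x z (Sum.inl a) (Sum.inl b) := by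
    intro κ
    have h := (Equiv.subRight (unitVec κ)).summable_iff.2 (hs1 κ)
    refine h.congr fun u => ?_
    simp only [Function.comp_apply, Equiv.subRight_apply, sub_add_cancel]
  have hshift : ∀ κ, ∑' u, lam κ' u' (u + unitVec κ) * S κ u x z (Sum.inl a) (Sum.inl b)
      = ∑' u, lam κ' u' u * S κ (u - unitVec κ) x z (Sum.inl a) (Sum.inl b) := by
    intro κ
    rw [← (Equiv.subRight (unitVec κ)).tsum_eq (fun u => lam κ' u' (u + unitVec κ) * S κ u x z (Sum.inl a) (Sum.inl b))]
    exact tsum_congr fun u => by simp only [Equiv.subRight_apply, sub_add_cancel]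
  rw [vertexW_apply]
  calc ∑ κ, ∑' u, dz (lam κ' u') κ u * S κ u x z (Sum.inl a) (Sum.inl b)
      = ∑ κ, (∑' u, lam κ' u' u * S κ (u - unitVec κ) x z (Sum.inl a) (Sum.inl b) - ∑' u, lam κ' u' u * S κ u x z (Sum.inl a) (Sum.inl b)) := by
        refine Finset.sum_congr rfl fun κ _ => ?_
        rw [← hshift κ, ← (hs1 κ).tsum_sub (hs2 κ)]
        exact tsum_congr fun u => by rw [dz]; ring
    _ = ∑' u, ∑ κ, (lam κ' u' u * S κ (u - unitVec κ) x z (Sum.inl a) (Sum.inl b) - lam κ' u' u * S κ u x z (Sum.inl a) (Sum.inl b)) := by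
        rw [Summable.tsum_finsetSum fun κ _ => (hs3 κ).sub (hs2 κ)]
        exact Finset.sum_congr rfl fun κ _ => ((hs3 κ).tsum_sub (hs2 κ)).symm
    _ = ∑' u, lam κ' u' u * divV S u x z (Sum.inl a) (Sum.inl b) := by
        refine tsum_congr fun u => ?_
        simp only [KernelWard.divV, Finset.sum_apply, Pi.sub_apply, b6UnitVec_eq, Finset.mul_sum, mul_sub]
    _ = 0 := by simp only [hdiv, Pi.zero_apply, mul_zero, tsum_zero]

/-- [folklore] **THE TABLE SLOT VANISHES**: `push₃ l r (dz λ) SΛ κ′ u′ x′ z′ (inl α) (inl β) = 0` (transversal family, bounded gauge functions). -/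
theorem push₃_gaugeTable_lambda_eq_zero (hL : 1 ≤ L) (hrr : rr ∈ box (d + 1) L) (hc : ∀ μ y κ u, |c μ y κ u| ≤ Cc * Real.exp (-δ * l1 ((L : ℤ) • y - u)))
    (hδ : 0 < δ) (hCc : 0 ≤ Cc) (hdiv : ∀ u, divV (SLam L c (fun μ y => symHessFFAt (toSite rr) L μ y)) u = 0)
    (hlam : ∀ μ y u, |lam μ y u| ≤ Clam) (κ' : Fin (d + 1)) (u' x' z' : Fin (d + 1) → ℤ) (α β : Fin (d + 1)) :
    push₃ l r (fun μ y κ u => dz (lam μ y) κ u) (SLam L c (fun μ y => symHessFFAt (toSite rr) L μ y)) κ' u' x' z' (Sum.inl α) (Sum.inl β) = 0 := by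
  rw [push₃_inl_inl]
  have h : ∀ z κ₂ x κ₁, l α x' κ₁ x *
      vertexW (fun μ y κ u => dz (lam μ y) κ u) (SLam L c (fun μ y => symHessFFAt (toSite rr) L μ y)) κ' u' x z (Sum.inl κ₁) (Sum.inl κ₂) = 0 := by
    intro z κ₂ x κ₁
    rw [vertexW_dz_lambda_eq_zero lam hL hrr hc hδ hCc hdiv hlam, mul_zero]
  simp only [h, Finset.sum_const_zero, tsum_zero, zero_mul]

end Table

/-! ## §4 TRANSPOSITION on the summable class (antisymmetry); the RIGHT SLOT -/

section Transpose

variable {l r w lam}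
variable {L : ℕ} {rr : Fin (d + 1) → ℕ} {c : Fin (d + 1) → (Fin (d + 1) → ℤ) → Fin (d + 1) → (Fin (d + 1) → ℤ) → ℝ} {Cc δ Cr Cw Cg : ℝ}

/-- [folklore] **THE PUSH OF THE Λ-PIECE IS ANTISYMMETRIC UNDER THE EXCHANGE OF ITS TWO KERNEL LEGS** (coarse arguments exchanged) ON THE SUMMABLE CLASS (left legs with
SUMMABLE fine rows, right and table legs BOUNDED; box root; coefficient letter): `push₃ l r w SΛ κ′ u′ x′ z′ (inl α) (inl β) = −push₃ r l w SΛ κ′ u′ z′ x′ (inl β) (inl α)`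
(`SLam_symHessFFAt_antisymm` entrywise + ONE genuine exchange by leaf-01's `tsum_comm_of_window` on the window `[−(2L−1), 2L−1]^{d+1}`). -/
theorem push₃_transpose_lambda (hL : 1 ≤ L) (hrr : rr ∈ box (d + 1) L) (hc : ∀ μ y κ u, |c μ y κ u| ≤ Cc * Real.exp (-δ * l1 ((L : ℤ) • y - u)))
    (hδ : 0 < δ) (hCc : 0 ≤ Cc) (hls : ∀ α x' κ, Summable fun x => l α x' κ x) (hr : ∀ β z' κ z, |r β z' κ z| ≤ Cr)
    (hw : ∀ κ' u' κ u, |w κ' u' κ u| ≤ Cw) (κ' : Fin (d + 1)) (u' x' z' : Fin (d + 1) → ℤ) (α β : Fin (d + 1)) :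
    push₃ l r w (SLam L c (fun μ y => symHessFFAt (toSite rr) L μ y)) κ' u' x' z' (Sum.inl α) (Sum.inl β)
      = -push₃ r l w (SLam L c (fun μ y => symHessFFAt (toSite rr) L μ y)) κ' u' z' x' (Sum.inl β) (Sum.inl α) := by
  classical
  haveI : NeZero L := ⟨by omega⟩
  set S := SLam L c (fun μ y => symHessFFAt (toSite rr) L μ y) with hSdef
  set Twin : Finset (Fin (d + 1) → ℤ) := Fintype.piFinset fun _ : Fin (d + 1) => Finset.Icc (-(2 * (L : ℤ) - 1)) (2 * (L : ℤ) - 1) with hTwin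
  have hCr : 0 ≤ Cr := (abs_nonneg _).trans (hr 0 0 0 0)
  obtain ⟨CV, hCV0, hVb⟩ := exists_vertexW_lambda_bound w hL hrr hc hδ hCc hw κ' u'
  have hwin : ∀ {x z : Fin (d + 1) → ℤ} {a b : Fin (d + 1)}, x - z ∉ Twin → vertexW w S κ' u' x z (Sum.inl a) (Sum.inl b) = 0 :=
    fun hxz => vertexW_lambda_eq_zero_of_not_window w hrr κ' u' hxz
  have hwin' : ∀ {x z : Fin (d + 1) → ℤ} {a b : Fin (d + 1)}, x - z ∉ Twin → vertexW w S κ' u' z x (Sum.inl b) (Sum.inl a) = 0 := by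
    intro x z a b hxz
    rw [vertexW_lambda_antisymm w (toSite rr) κ' u' z x b a, hwin hxz, neg_zero]
  -- finite support of the inner sums
  have hsxV : ∀ z a b, Summable fun x => l α x' a x * vertexW w S κ' u' x z (Sum.inl a) (Sum.inl b) := by
    intro z a b
    refine summable_of_finsupp (Twin.image fun t => z + t) fun x hx => ?_
    have hx' : x - z ∉ Twin := fun h => hx (Finset.mem_image.2 ⟨x - z, h, by abel⟩)
    rw [hwin hx', mul_zero]
  have hszV : ∀ x a b, Summable fun z => r β z' b z * vertexW w S κ' u' z x (Sum.inl b) (Sum.inl a) := by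
    intro x a b
    refine summable_of_finsupp (Twin.image fun t => x - t) fun z hz => ?_
    have hz' : x - z ∉ Twin := fun h => hz (Finset.mem_image.2 ⟨x - z, h, by abel⟩)
    rw [hwin' hz', mul_zero]
  have h1 : ∀ z, (∑ b, (∑' x, ∑ a, l α x' a x * vertexW w S κ' u' x z (Sum.inl a) (Sum.inl b)) * r β z' b z)
      = ∑' x, ∑ a, ∑ b, l α x' a x * vertexW w S κ' u' x z (Sum.inl a) (Sum.inl b) * r β z' b z := by
    intro z
    calc (∑ b, (∑' x, ∑ a, l α x' a x * vertexW w S κ' u' x z (Sum.inl a) (Sum.inl b)) * r β z' b z)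
        = ∑ b, ∑ a, ∑' x, l α x' a x * vertexW w S κ' u' x z (Sum.inl a) (Sum.inl b) * r β z' b z := by
          refine Finset.sum_congr rfl fun b _ => ?_
          rw [Summable.tsum_finsetSum fun a _ => hsxV z a b, Finset.sum_mul]
          refine Finset.sum_congr rfl fun a _ => ?_
          rw [← tsum_mul_right]
      _ = ∑ b, ∑' x, ∑ a, l α x' a x * vertexW w S κ' u' x z (Sum.inl a) (Sum.inl b) * r β z' b z := by
          refine Finset.sum_congr rfl fun b _ => ?_
          rw [Summable.tsum_finsetSum fun a _ => (hsxV z a b).mul_right _]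
      _ = ∑' x, ∑ b, ∑ a, l α x' a x * vertexW w S κ' u' x z (Sum.inl a) (Sum.inl b) * r β z' b z := by
          rw [Summable.tsum_finsetSum fun b _ => summable_sum fun a _ => (hsxV z a b).mul_right _]
      _ = _ := tsum_congr fun x => Finset.sum_comm
  have h2 : ∀ x, (∑ a, (∑' z, ∑ b, r β z' b z * vertexW w S κ' u' z x (Sum.inl b) (Sum.inl a)) * l α x' a x)
      = -∑' z, ∑ a, ∑ b, l α x' a x * vertexW w S κ' u' x z (Sum.inl a) (Sum.inl b) * r β z' b z := by
    intro x
    rw [← tsum_neg]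
    calc (∑ a, (∑' z, ∑ b, r β z' b z * vertexW w S κ' u' z x (Sum.inl b) (Sum.inl a)) * l α x' a x)
        = ∑ a, ∑ b, ∑' z, r β z' b z * vertexW w S κ' u' z x (Sum.inl b) (Sum.inl a) * l α x' a x := by
          refine Finset.sum_congr rfl fun a _ => ?_
          rw [Summable.tsum_finsetSum fun b _ => hszV x a b, Finset.sum_mul]
          refine Finset.sum_congr rfl fun b _ => ?_
          rw [← tsum_mul_right]
      _ = ∑ a, ∑' z, ∑ b, r β z' b z * vertexW w S κ' u' z x (Sum.inl b) (Sum.inl a) * l α x' a x := by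
          refine Finset.sum_congr rfl fun a _ => ?_
          rw [Summable.tsum_finsetSum fun b _ => (hszV x a b).mul_right _]
      _ = ∑' z, ∑ a, ∑ b, r β z' b z * vertexW w S κ' u' z x (Sum.inl b) (Sum.inl a) * l α x' a x := by
          rw [Summable.tsum_finsetSum fun a _ => summable_sum fun b _ => (hszV x a b).mul_right _]
      _ = _ := by
          refine tsum_congr fun z => ?_
          rw [← Finset.sum_neg_distrib]
          refine Finset.sum_congr rfl fun a _ => ?_
          rw [← Finset.sum_neg_distrib]
          refine Finset.sum_congr rfl fun b _ => ?_
          rw [vertexW_lambda_antisymm w (toSite rr) κ' u' x z a b]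
          ring
  rw [push₃_inl_inl, push₃_inl_inl, tsum_congr h1, tsum_congr h2, tsum_neg, neg_neg]
  refine tsum_comm_of_window (Θ := fun x z => ∑ a, ∑ b, l α x' a x * vertexW w S κ' u' x z (Sum.inl a) (Sum.inl b) * r β z' b z)
    Twin (fun x z hxz => ?_) (fun t _ => ?_)
  · exact Finset.sum_eq_zero fun a _ => Finset.sum_eq_zero fun b _ => by rw [hwin hxz, mul_zero, zero_mul]
  · have hls' : ∀ a, Summable fun z => |l α x' a (z + t)| * (CV * Cr) := by
      intro a
      have h := ((Equiv.addRight t).summable_iff.2 (hls α x' a)).abs.mul_right (CV * Cr)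
      exact h.congr fun z => by simp only [Function.comp_apply, Equiv.coe_addRight]
    have hg : Summable fun z => ∑ a : Fin (d + 1), ∑ _b : Fin (d + 1), |l α x' a (z + t)| * (CV * Cr) :=
      summable_sum fun a _ => summable_sum fun _ _ => hls' a
    refine Summable.of_norm_bounded hg (fun z => ?_)
    rw [Real.norm_eq_abs]
    refine (Finset.abs_sum_le_sum_abs _ _).trans (Finset.sum_le_sum fun a _ => ?_)
    refine (Finset.abs_sum_le_sum_abs _ _).trans (Finset.sum_le_sum fun b _ => ?_)
    rw [abs_mul, abs_mul, mul_assoc]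
    exact mul_le_mul_of_nonneg_left (mul_le_mul (hVb _ _ _ _) (hr β z' b z) (abs_nonneg _) hCV0) (abs_nonneg _)

/-- [folklore] **THE RIGHT SLOT** on the summable class: `push₃ l (dz λ) w SΛ κ′ u′ x′ z′ (inl α) (inl β) = −Σ'_x Σ_a l α x′ a x · Σ'_u Σ_κ w κ′ u′ κ u · KΛ(λ_{βz′}; κ,u; a,x)` —
minus the left cell with the legs exchanged. -/
theorem push₃_gaugeRight_lambda (hL : 1 ≤ L) (hrr : rr ∈ box (d + 1) L) (hc : ∀ μ y κ u, |c μ y κ u| ≤ Cc * Real.exp (-δ * l1 ((L : ℤ) • y - u)))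
    (hδ : 0 < δ) (hCc : 0 ≤ Cc) (hls : ∀ α x' κ, Summable fun x => l α x' κ x) (hlam : ∀ μ y κ u, |dz (lam μ y) κ u| ≤ Cg)
    (hw : ∀ κ' u' κ u, |w κ' u' κ u| ≤ Cw) (κ' : Fin (d + 1)) (u' x' z' : Fin (d + 1) → ℤ) (α β : Fin (d + 1)) :
    push₃ l (fun μ y κ u => dz (lam μ y) κ u) w (SLam L c (fun μ y => symHessFFAt (toSite rr) L μ y)) κ' u' x' z' (Sum.inl α) (Sum.inl β)
      = -∑' x, ∑ a, l α x' a x * ∑' u, ∑ κ, w κ' u' κ u *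
          -(∑ μ, ∑' y, c μ y κ u *
            ((lam β z' x + lam β z' (x + unitVec a) - lam β z' ((L : ℤ) • y + toSite rr) - lam β z' ((L : ℤ) • y + toSite rr + (L : ℤ) • unitVec μ))
              * symLinKerAt (toSite rr) L μ y (a, x) / 2)) := by
  rw [push₃_transpose_lambda hL hrr hc hδ hCc (r := fun μ y κ u => dz (lam μ y) κ u) hls hlam hw,
    push₃_gaugeLeft_lambda l w lam hL hrr hc hδ hCc hw]

end Transpose

/-! ## §5 The kernel socket: two Λ one-gauge cells -/

section Cells

variable {lE lB rE rB wE wB : Fin (d + 1) → (Fin (d + 1) → ℤ) → Fin (d + 1) → (Fin (d + 1) → ℤ) → ℝ}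
variable {lamL lamR lamW : Fin (d + 1) → (Fin (d + 1) → ℤ) → (Fin (d + 1) → ℤ) → ℝ} {ClE ClB CrE CrB CwE CwB ClamW : ℝ}
variable {L : ℕ} {rr : Fin (d + 1) → ℕ} {c : Fin (d + 1) → (Fin (d + 1) → ℤ) → Fin (d + 1) → (Fin (d + 1) → ℤ) → ℝ} {Cc δ : ℝ}

/-- [folklore] **THE CONTACT TERM OF THE Λ PUSH IS TWO Λ ONE-GAUGE CELLS** (summable class: every leg bounded with summable fine slices; readings differing slot by slot
by pure gauges `lᴱ − lᴮ = dz λ_L`, `rᴱ − rᴮ = dz λ_R`, `wᴱ − wᴮ = dz λ_W` with `λ_W` BOUNDED; coefficient letter; TRANSVERSALITY `divV SΛ = 0` kills the table term):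
`push₃ lᴱ rᴱ wᴱ SΛ − push₃ lᴮ rᴮ wᴮ SΛ` `(x′,z′,inl α,inl β)` `= Σ'_z Σ_b rᴱ β z′ b z · Σ'_u Σ_κ wᴱ κ′ u′ κ u · KΛ_sym(λ_L αx′; κ,u; b,z) − Σ'_x Σ_a lᴮ α x′ a x · Σ'_u Σ_κ wᴱ κ′ u′ κ u · KΛ_sym(λ_R βz′; κ,u; a,x)`
(the right-slot term is MINUS the left-type cell with the legs exchanged) — each term is `ContactOneGaugeCellLambda.cellLambda_eq`'s right-hand side, bounded by
`abs_cellLambda_le`. -/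
theorem contact_lambda_eq_cells (hL : 1 ≤ L) (hrr : rr ∈ box (d + 1) L) (hc : ∀ μ y κ u, |c μ y κ u| ≤ Cc * Real.exp (-δ * l1 ((L : ℤ) • y - u)))
    (hδ : 0 < δ) (hCc : 0 ≤ Cc) (hdiv : ∀ u, divV (SLam L c (fun μ y => symHessFFAt (toSite rr) L μ y)) u = 0)
    (hlE : ∀ α x' κ x, |lE α x' κ x| ≤ ClE) (hlEs : ∀ α x' κ, Summable fun x => lE α x' κ x)
    (hlB : ∀ α x' κ x, |lB α x' κ x| ≤ ClB) (hlBs : ∀ α x' κ, Summable fun x => lB α x' κ x)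
    (hrE : ∀ β z' κ z, |rE β z' κ z| ≤ CrE) (hrEs : ∀ β z' κ, Summable fun z => rE β z' κ z)
    (hrB : ∀ β z' κ z, |rB β z' κ z| ≤ CrB) (hrBs : ∀ β z' κ, Summable fun z => rB β z' κ z)
    (hwE : ∀ κ' u' κ u, |wE κ' u' κ u| ≤ CwE) (hwB : ∀ κ' u' κ u, |wB κ' u' κ u| ≤ CwB)
    (hLg : lE - lB = fun μ y κ u => dz (lamL μ y) κ u) (hRg : rE - rB = fun μ y κ u => dz (lamR μ y) κ u)
    (hWg : wE - wB = fun μ y κ u => dz (lamW μ y) κ u) (hlamW : ∀ μ y u, |lamW μ y u| ≤ ClamW)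
    (κ' : Fin (d + 1)) (u' x' z' : Fin (d + 1) → ℤ) (α β : Fin (d + 1)) :
    push₃ lE rE wE (SLam L c (fun μ y => symHessFFAt (toSite rr) L μ y)) κ' u' x' z' (Sum.inl α) (Sum.inl β)
        - push₃ lB rB wB (SLam L c (fun μ y => symHessFFAt (toSite rr) L μ y)) κ' u' x' z' (Sum.inl α) (Sum.inl β)
      = (∑' z, ∑ b, rE β z' b z * ∑' u, ∑ κ, wE κ' u' κ u *
            -(∑ μ, ∑' y, c μ y κ u *
              ((lamL α x' z + lamL α x' (z + unitVec b) - lamL α x' ((L : ℤ) • y + toSite rr) - lamL α x' ((L : ℤ) • y + toSite rr + (L : ℤ) • unitVec μ))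
                * symLinKerAt (toSite rr) L μ y (b, z) / 2)))
        - (∑' x, ∑ a, lB α x' a x * ∑' u, ∑ κ, wE κ' u' κ u *
            -(∑ μ, ∑' y, c μ y κ u *
              ((lamR β z' x + lamR β z' (x + unitVec a) - lamR β z' ((L : ℤ) • y + toSite rr) - lamR β z' ((L : ℤ) • y + toSite rr + (L : ℤ) • unitVec μ))
                * symLinKerAt (toSite rr) L μ y (a, x) / 2))) := by
  have hS := locStencil_SLam_symHessFFAt hL hrr hc hδ hCc
  have hδ2 : 0 < δ / 2 := by linarith
  have hgR : ∀ μ y κ u, |dz (lamR μ y) κ u| ≤ CrE + CrB := by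
    intro μ y κ u
    have e : dz (lamR μ y) κ u = (rE - rB) μ y κ u := by rw [hRg]
    rw [e, Pi.sub_apply, Pi.sub_apply, Pi.sub_apply, Pi.sub_apply]
    exact (abs_sub _ _).trans (add_le_add (hrE μ y κ u) (hrB μ y κ u))
  have h1 := push₃_sub_left hlE hlEs hlB hlBs hrEs hwE hS hδ2 κ' u'
  have h2 := push₃_sub_right hlB hrEs hrBs hwE hS hδ2 κ' u'
  have h3 := push₃_sub_table hlB hlBs hrBs hwE hwB hS hδ2 κ' u'
  have e1 := congrFun (congrFun (congrFun (congrFun h1 x') z') (Sum.inl α)) (Sum.inl β)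
  have e2 := congrFun (congrFun (congrFun (congrFun h2 x') z') (Sum.inl α)) (Sum.inl β)
  have e3 := congrFun (congrFun (congrFun (congrFun h3 x') z') (Sum.inl α)) (Sum.inl β)
  simp only [Pi.sub_apply] at e1 e2 e3
  have e : push₃ lE rE wE (SLam L c (fun μ y => symHessFFAt (toSite rr) L μ y)) κ' u' x' z' (Sum.inl α) (Sum.inl β)
        - push₃ lB rB wB (SLam L c (fun μ y => symHessFFAt (toSite rr) L μ y)) κ' u' x' z' (Sum.inl α) (Sum.inl β)
      = push₃ (lE - lB) rE wE (SLam L c (fun μ y => symHessFFAt (toSite rr) L μ y)) κ' u' x' z' (Sum.inl α) (Sum.inl β)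
        + push₃ lB (rE - rB) wE (SLam L c (fun μ y => symHessFFAt (toSite rr) L μ y)) κ' u' x' z' (Sum.inl α) (Sum.inl β)
        + push₃ lB rB (wE - wB) (SLam L c (fun μ y => symHessFFAt (toSite rr) L μ y)) κ' u' x' z' (Sum.inl α) (Sum.inl β) := by
    rw [e1, e2, e3]; ring
  rw [e, hLg, hRg, hWg, push₃_gaugeLeft_lambda rE wE lamL hL hrr hc hδ hCc hwE,
    push₃_gaugeRight_lambda hL hrr hc hδ hCc hlBs hgR hwE, push₃_gaugeTable_lambda_eq_zero lB rB lamW hL hrr hc hδ hCc hdiv hlamW]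
  ring

end Cells

end Summit.QuantumFields.BalabanUV.Beta.GAN24.SymPush3LambdaKernelCells

end
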